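import Mathlib
import Summits.ResolutionOfSingularities.ResolutionOfSingularities.Theorems.WeightedInvariantLocalWeightedDropMonomialCloudPairs

/-!
# `WeightedInvariant.LocalWeightedDrop`, line `tame-four-tuple-drop`: the potential of an exponent cloud and the winning move of the
# marked polyhedra game (combinatorial core of the monomial phase, any number of variables)

Crux item stmt-ResolutionOfSingularities-8899 `LocalWeightedDrop` (route `ResolutionOfSingularities/WeightedInvariant`); stub (B3)
`stub_spaceMonomialPhase` of strategist res-L1-w43-strat-1's line `tame-four-tuple-drop`.  [OURS · L1 W4.3, chain w43, unit res-L1-w43-stub-8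
(seat res-D-pv-006).  The mathematics is Hironaka's polyhedra game: the pair step of arXiv:1907.02094 Prop. 2.2 (file `…MonomialCloudPairs`), the
observation (ibid. Thm 5.2) that the game moves preserve componentwise comparability, and the classical order reduction of a PRINCIPAL marked
monomial ideal by centres of minimal codimension count; NOT a statement of any manuscript under adjudication.]

A CLOUD is a finite family `v : S → (Fin n → ℕ)` of exponent vectors (the normalised exponents of the non-zero entries of a coefficient tuple
presented by unit monomials).  The tuple game's move with centre `{xᵢ = 0 : i ∈ J}` at an exceptional point with live slot `l ∈ J`, the
other live coordinates `Z ⊆ J ∖ {l}` becoming units, and common floor shift `c = L·W`, sends every vector `v_j` to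
`succ J l Z c v_j = (i ↦ Σ_J v_j − c at i = l, 0 on Z, v_j i elsewhere)` (then re-indexes the coordinates, which the potential ignores).

* `incPairs v`, `mu v` — the incomparable pairs of the cloud and THE POTENTIAL: `min_j |v_j|` if the cloud is a chain, else
  `ω²·#incPairs + min over incomparable pairs of (ω·min + max of the two excesses)`; `mu v < ω³` (`mu_lt`).
* `incPairs_succ_subset` — comparabilities survive every move; `mu_succ_lt_of_incPairs` — PHASE A (the cloud is not a chain): the Perron move of a
  pair achieving the minimum lowers `mu` at every successor, any shift `c ≤ Σ_J`; `mu_succ_lt_of_chain` — PHASE B (a chain, all `|v_j| ≥ L ≥ 1`):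
  the minimal-cardinality permissible set of the least vector is permissible for every vector and lowers `mu` at every successor with `c ≥ L`.
* `exists_move` — THE STEP: from a cloud with all `|v_j| ≥ L` (`L ≥ 1`, `S` non-empty) there is `J ≠ ∅` such that for every `W` with
  `L·W ≤ Σ_J v_j` for all `j` and `W ≥ 1` whenever `J` is permissible for all `j`, every successor has smaller `mu`.
* `mu_comp_equiv`, `mu_comp_index_equiv` — `mu` is invariant under a common re-indexing of the coordinates and under re-indexing the points.
-/

set_option linter.dupNamespace false -- mandated namespace of this single-conjunct summit

namespace Summit.ResolutionOfSingularities.ResolutionOfSingularities.Theorems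

namespace MonomialCloud

open Finset Ordinal

variable {S : Type} [Fintype S] {n : ℕ}

/-! ### Incomparable pairs, chains, the least vector -/
/-- The (ordered) incomparable pairs of the cloud. -/
def incPairs (v : S → Fin n → ℕ) : Finset (S × S) :=
  univ.filter fun p => 0 < posExcess (v p.1) (v p.2) ∧ 0 < posExcess (v p.2) (v p.1)

/-- Membership in `incPairs`. -/
theorem mem_incPairs {v : S → Fin n → ℕ} {p : S × S} :
    p ∈ incPairs v ↔ 0 < posExcess (v p.1) (v p.2) ∧ 0 < posExcess (v p.2) (v p.1) := by
  simp [incPairs]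

/-- The total degree `|v_j|`. -/
def total (w : Fin n → ℕ) : ℕ := ∑ i, w i

/-- In a chain (no incomparable pair) a vector of least total degree is componentwise least. -/
theorem exists_least_of_incPairs_eq_empty {v : S → Fin n → ℕ} (h : incPairs v = ∅) (j₁ : S) :
    ∃ j₀, ∀ j i, v j₀ i ≤ v j i := by
  obtain ⟨j₀, -, hmin⟩ := exists_min_image univ (fun j => total (v j)) ⟨j₁, mem_univ _⟩
  refine ⟨j₀, fun j => ?_⟩
  have hp : (j₀, j) ∉ incPairs v := by rw [h]; exact Finset.notMem_empty _
  rw [mem_incPairs, not_and_or, not_lt, not_lt, Nat.le_zero, Nat.le_zero, posExcess_eq_zero_iff, posExcess_eq_zero_iff] at hp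
  rcases hp with hp | hp
  · exact hp
  · -- `v j ≤ v j₀` with `|v j₀| ≤ |v j|` forces equality
    have hle : total (v j₀) ≤ total (v j) := hmin j (mem_univ _)
    have heq : ∀ i, v j i = v j₀ i := by
      by_contra hne
      push Not at hne
      obtain ⟨i₀, hi₀⟩ := hne
      have hlt : v j i₀ < v j₀ i₀ := lt_of_le_of_ne (hp i₀) hi₀
      have : total (v j) < total (v j₀) :=
        Finset.sum_lt_sum (fun i _ => hp i) ⟨i₀, mem_univ _, hlt⟩
      omega
    exact fun i => (heq i).symm.le

/-! ### The pair key as an ordinal and the potential -/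
/-- `ω · min a b + max a b`. -/
noncomputable def pairOrd (a b : ℕ) : Ordinal.{0} := ω * ((min a b : ℕ) : Ordinal.{0}) + ((max a b : ℕ) : Ordinal.{0})

/-- `ω·m + x < ω·m′ + y` for `m < m′`, `x < ω`. -/
theorem omega0_mul_add_lt {m m' x : ℕ} (y : Ordinal.{0}) (hx : (x : Ordinal.{0}) < ω) (h : m < m') :
    ω * (m : Ordinal.{0}) + x < ω * (m' : Ordinal.{0}) + y :=
  calc ω * (m : Ordinal.{0}) + x < ω * (m : Ordinal.{0}) + ω := (add_lt_add_iff_left _).mpr hx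
    _ = ω * ((m + 1 : ℕ) : Ordinal.{0}) := by rw [Nat.cast_succ, mul_add_one]
    _ ≤ ω * (m' : Ordinal.{0}) := mul_le_mul_right (by exact_mod_cast h) _
    _ ≤ _ := le_self_add

/-- The ordinal key is strictly monotone in the lexicographic pair key. -/
theorem pairOrd_lt_of_pairKey_lt {a' b' a b : ℕ} (h : pairKey a' b' < pairKey a b) : pairOrd a' b' < pairOrd a b := by
  rw [pairKey_lt_iff] at h
  unfold pairOrd
  rcases h with h | ⟨h1, h2⟩
  · exact omega0_mul_add_lt _ (natCast_lt_omega0 _) h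
  · rw [h1]; exact (add_lt_add_iff_left _).mpr (by exact_mod_cast h2)

/-- The ordinal key is monotone in the lexicographic pair key. -/
theorem pairOrd_le_of_pairKey_le {a' b' a b : ℕ} (h : pairKey a' b' ≤ pairKey a b) : pairOrd a' b' ≤ pairOrd a b := by
  rcases lt_or_eq_of_le h with h | h
  · exact (pairOrd_lt_of_pairKey_lt h).le
  · unfold pairOrd
    have h' := h
    unfold pairKey at h'
    have h1 : min a' b' = min a b := congrArg (fun p => (ofLex p).1) h'
    have h2 : max a' b' = max a b := congrArg (fun p => (ofLex p).2) h'
    rw [h1, h2]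

/-- `pairOrd < ω²`. -/
theorem pairOrd_lt_omega0_sq (a b : ℕ) : pairOrd a b < ω ^ 2 := by
  unfold pairOrd
  calc ω * ((min a b : ℕ) : Ordinal.{0}) + ((max a b : ℕ) : Ordinal.{0})
      < ω * ((min a b : ℕ) : Ordinal.{0}) + ω := (add_lt_add_iff_left _).mpr (natCast_lt_omega0 _)
    _ = ω * ((min a b + 1 : ℕ) : Ordinal.{0}) := by rw [Nat.cast_succ, mul_add_one]
    _ ≤ ω * ω := mul_le_mul_right (natCast_lt_omega0 _).le _
    _ = ω ^ 2 := (pow_two _).symm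

/-- The pair key of the incomparable pair `p`, as an ordinal. -/
noncomputable def pairPot (v : S → Fin n → ℕ) (p : S × S) : Ordinal.{0} :=
  pairOrd (posExcess (v p.1) (v p.2)) (posExcess (v p.2) (v p.1))

/-- THE POTENTIAL OF A CLOUD: `min_j |v_j|` for a chain, else `ω² · #incPairs + min over incomparable pairs of the pair key`. -/
noncomputable def mu (v : S → Fin n → ℕ) : Ordinal.{0} :=
  if h : (incPairs v).Nonempty then
    ω ^ 2 * (((incPairs v).card : ℕ) : Ordinal.{0}) + ((incPairs v).image (pairPot v)).min' (h.image _)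
  else ((⨅ j, total (v j) : ℕ) : Ordinal.{0})

/-- `mu < ω³`. -/
theorem mu_lt (v : S → Fin n → ℕ) : mu v < ω ^ 3 := by
  unfold mu
  split_ifs with h
  · have hmem := Finset.min'_mem ((incPairs v).image (pairPot v)) (h.image _)
    obtain ⟨p, -, hp⟩ := Finset.mem_image.mp hmem
    rw [← hp]
    calc ω ^ 2 * (((incPairs v).card : ℕ) : Ordinal.{0}) + pairPot v p
        < ω ^ 2 * (((incPairs v).card : ℕ) : Ordinal.{0}) + ω ^ 2 := (add_lt_add_iff_left _).mpr (pairOrd_lt_omega0_sq _ _)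
      _ = ω ^ 2 * (((incPairs v).card + 1 : ℕ) : Ordinal.{0}) := by rw [Nat.cast_succ, mul_add_one]
      _ ≤ ω ^ 2 * ω := mul_le_mul_right (natCast_lt_omega0 _).le _
      _ = ω ^ 3 := (pow_succ _ 2).symm
  · calc ((⨅ j, total (v j) : ℕ) : Ordinal.{0}) < ω := natCast_lt_omega0 _
      _ ≤ ω ^ 3 := le_self_pow one_lt_omega0.le (by norm_num)

/-! ### The successor of a move and the survival of comparabilities -/
/-- THE SUCCESSOR VECTOR: `Σ_J v − c` at the live slot `l`, `0` on the coordinates `Z` that became units, `v i` elsewhere. -/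
def succ (J : Finset (Fin n)) (l : Fin n) (Z : Finset (Fin n)) (c : ℕ) (w : Fin n → ℕ) : Fin n → ℕ :=
  fun i => if i = l then (∑ i' ∈ J, w i') - c else if i ∈ Z then 0 else w i

/-- Componentwise `≤` survives the move. -/
theorem succ_le_succ {J : Finset (Fin n)} {l : Fin n} {Z : Finset (Fin n)} {c : ℕ} {w w' : Fin n → ℕ}
    (h : ∀ i, w i ≤ w' i) : ∀ i, succ J l Z c w i ≤ succ J l Z c w' i := by
  intro i
  unfold succ
  split_ifs
  · exact Nat.sub_le_sub_right (Finset.sum_le_sum fun i _ => h i) c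
  · exact le_rfl
  · exact h i

/-- Incomparability after the move implies incomparability before. -/
theorem incPairs_succ_subset (J : Finset (Fin n)) (l : Fin n) (Z : Finset (Fin n)) (c : ℕ) (v : S → Fin n → ℕ) :
    incPairs (fun j => succ J l Z c (v j)) ⊆ incPairs v := by
  intro p hp
  rw [mem_incPairs] at hp ⊢
  obtain ⟨h1, h2⟩ := hp
  constructor
  · by_contra h0
    rw [not_lt, Nat.le_zero, posExcess_eq_zero_iff] at h0
    have := (posExcess_eq_zero_iff _ _).mpr (succ_le_succ (J := J) (l := l) (Z := Z) (c := c) h0)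
    omega
  · by_contra h0
    rw [not_lt, Nat.le_zero, posExcess_eq_zero_iff] at h0
    have := (posExcess_eq_zero_iff _ _).mpr (succ_le_succ (J := J) (l := l) (Z := Z) (c := c) h0)
    omega

/-- The successor is the zeroing on `Z` of the shifted push (when `l ∉ Z`). -/
theorem succ_eq (J : Finset (Fin n)) {l : Fin n} {Z : Finset (Fin n)} (hl : l ∉ Z) (c : ℕ) (w : Fin n → ℕ) :
    succ J l Z c w = fun i => if i ∈ Z then 0 else Function.update w l ((∑ i' ∈ J, w i') - c) i := by
  funext i
  unfold succ
  by_cases hi : i = l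
  · subst hi; simp [hl]
  · simp [hi]

/-- THE PAIR KEY DOES NOT GROW BEYOND THE PUSHED PAIR: for `c ≤ Σ_J` of the second vector and `l ∉ Z`, the excess of the successors is at
most that of the pushed vectors. -/
theorem posExcess_succ_le {J : Finset (Fin n)} {l : Fin n} {Z : Finset (Fin n)} (hl : l ∉ Z) {c : ℕ} {w w' : Fin n → ℕ}
    (hc' : c ≤ ∑ i ∈ J, w' i) :
    posExcess (succ J l Z c w) (succ J l Z c w') ≤ posExcess (push J l w) (push J l w') := by
  rw [succ_eq J hl, succ_eq J hl]
  refine (posExcess_zero_le _ _ Z).trans (le_of_eq ?_)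
  rw [← push_sub_eq_update, ← push_sub_eq_update]
  apply posExcess_update_eq
  rw [push_apply_self, push_apply_self]
  omega

/-- `ω²·k′ + x < ω²·k + y` for `k′ < k` and `x < ω²`. -/
theorem omega0_sq_mul_add_lt {k k' : ℕ} (hk : k' < k) (x : Ordinal.{0}) (hx : x < ω ^ 2) (y : Ordinal.{0}) :
    ω ^ 2 * ((k' : ℕ) : Ordinal.{0}) + x < ω ^ 2 * ((k : ℕ) : Ordinal.{0}) + y :=
  calc ω ^ 2 * ((k' : ℕ) : Ordinal.{0}) + x
      < ω ^ 2 * ((k' : ℕ) : Ordinal.{0}) + ω ^ 2 := (add_lt_add_iff_left _).mpr hx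
    _ = ω ^ 2 * ((k' + 1 : ℕ) : Ordinal.{0}) := by rw [Nat.cast_succ, mul_add_one]
    _ ≤ ω ^ 2 * ((k : ℕ) : Ordinal.{0}) := mul_le_mul_right (by exact_mod_cast hk) _
    _ ≤ _ := le_self_add

/-! ### Phase A: the cloud is not a chain -/
/-- PHASE A STEP: if the cloud has an incomparable pair, the Perron move of a pair achieving the least pair key lowers `mu` at every successor
(`l ∈ J`, `Z ⊆ J ∖ {l}`, any common shift `c ≤ Σ_J v_j`). -/
theorem mu_succ_lt_of_incPairs {v : S → Fin n → ℕ} (h : (incPairs v).Nonempty) :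
    ∃ J : Finset (Fin n), J.Nonempty ∧ ∀ l ∈ J, ∀ Z ⊆ J.erase l, ∀ c : ℕ, (∀ j, c ≤ ∑ i ∈ J, v j i) →
      mu (fun j => succ J l Z c (v j)) < mu v := by
  classical
  -- a pair achieving the least key
  obtain ⟨p, hp, hpmin⟩ := exists_min_image (incPairs v) (pairPot v) h
  have hp' := mem_incPairs.mp hp
  obtain ⟨J, hJ, hstep⟩ := exists_push_pairLt (v p.1) (v p.2) hp'.1 hp'.2
  refine ⟨J, hJ, fun l hl Z hZ c hc => ?_⟩
  have hlZ : l ∉ Z := fun hmem => Finset.notMem_erase l J (hZ hmem)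
  set v' : S → Fin n → ℕ := fun j => succ J l Z c (v j) with hv'
  have hsub : incPairs v' ⊆ incPairs v := incPairs_succ_subset J l Z c v
  have hμv : mu v = ω ^ 2 * (((incPairs v).card : ℕ) : Ordinal.{0}) + ((incPairs v).image (pairPot v)).min' (h.image _) := by
    unfold mu; rw [dif_pos h]
  by_cases hcard : (incPairs v').card < (incPairs v).card
  · -- fewer incomparable pairs
    rw [hμv]
    unfold mu
    split_ifs with h'
    · have hmem := Finset.min'_mem ((incPairs v').image (pairPot v')) (h'.image _)
      obtain ⟨q, -, hq⟩ := Finset.mem_image.mp hmem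
      rw [← hq]
      exact omega0_sq_mul_add_lt hcard _ (pairOrd_lt_omega0_sq _ _) _
    · calc ((⨅ j, total (v' j) : ℕ) : Ordinal.{0}) < ω ^ 2 := lt_of_lt_of_le (natCast_lt_omega0 _)
            (by rw [pow_two]; exact Ordinal.le_mul_left ω omega0_pos)
        _ ≤ ω ^ 2 * (((incPairs v).card : ℕ) : Ordinal.{0}) := by
            apply Ordinal.le_mul_left
            exact_mod_cast Finset.card_pos.mpr h
        _ ≤ _ := le_self_add
  · -- the same incomparable pairs: the chosen pair's key drops
    have heq : incPairs v' = incPairs v := Finset.eq_of_subset_of_card_le hsub (not_lt.mp hcard)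
    have h' : (incPairs v').Nonempty := by rw [heq]; exact h
    have hμv' : mu v' = ω ^ 2 * (((incPairs v').card : ℕ) : Ordinal.{0}) +
        ((incPairs v').image (pairPot v')).min' (h'.image _) := by unfold mu; rw [dif_pos h']
    have hcardeq : (incPairs v').card = (incPairs v).card := by rw [heq]
    rw [hμv, hμv', hcardeq]
    have hp2 : p ∈ incPairs v' := by rw [heq]; exact hp
    have hA : ((incPairs v').image (pairPot v')).min' (h'.image _) ≤ pairPot v' p :=
      Finset.min'_le _ _ (Finset.mem_image_of_mem _ hp2)
    have hB : pairPot v' p < pairPot v p := by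
      unfold pairPot
      refine pairOrd_lt_of_pairKey_lt (lt_of_le_of_lt (pairKey_le_of_le ?_ ?_) (hstep l hl))
      · exact posExcess_succ_le hlZ (hc p.2)
      · exact posExcess_succ_le hlZ (hc p.1)
    have hC : pairPot v p ≤ ((incPairs v).image (pairPot v)).min' (h.image _) :=
      Finset.le_min' _ _ _ fun o ho => by
        obtain ⟨q, hq, rfl⟩ := Finset.mem_image.mp ho
        exact hpmin q hq
    have hA' : ((incPairs v').image (pairPot v')).min' (h'.image _) < ((incPairs v).image (pairPot v)).min' (h.image _) :=
      lt_of_le_of_lt hA (lt_of_lt_of_le hB hC)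
    exact (add_lt_add_iff_left _).mpr hA'

/-! ### Phase B: the cloud is a chain -/
/-- The total degree of the successor of the least vector drops when `Σ_{J ∖ l} v < L ≤ c`. -/
theorem total_succ_lt {J : Finset (Fin n)} {l : Fin n} (hl : l ∈ J) {Z : Finset (Fin n)} (hZ : Z ⊆ J.erase l) {c L : ℕ}
    {w : Fin n → ℕ} (hc : c ≤ ∑ i ∈ J, w i) (hLc : L ≤ c) (hsmall : ∑ i ∈ J.erase l, w i < L) :
    total (succ J l Z c w) < total w := by
  have hlZ : l ∉ Z := fun hmem => Finset.notMem_erase l J (hZ hmem)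
  unfold total
  rw [sum_eq_add_sum_erase _ l, sum_eq_add_sum_erase w l]
  have h1 : succ J l Z c w l = (∑ i ∈ J, w i) - c := by simp [succ]
  have h2 : ∑ i ∈ univ.erase l, succ J l Z c w i ≤ ∑ i ∈ univ.erase l, w i :=
    Finset.sum_le_sum fun i hi => by
      have hil : i ≠ l := Finset.ne_of_mem_erase hi
      simp only [succ, hil, if_false]
      split_ifs <;> omega
  have h3 : ∑ i ∈ J, w i = w l + ∑ i ∈ J.erase l, w i := (Finset.add_sum_erase _ _ hl).symm
  omega

/-- PHASE B STEP: if the cloud is a chain and every `|v_j| ≥ L ≥ 1`, the minimal-cardinality set `J` with `Σ_J v_{j₀} ≥ L` for the least vector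
`v_{j₀}` is permissible for every vector, and every successor with shift `c ≥ L` (`c ≤ Σ_J v_j`) has smaller `mu`. -/
theorem mu_succ_lt_of_chain {v : S → Fin n → ℕ} (h : incPairs v = ∅) (j₁ : S) {L : ℕ} (hL : 1 ≤ L)
    (hbad : ∀ j, L ≤ total (v j)) :
    ∃ J : Finset (Fin n), J.Nonempty ∧ (∀ j, L ≤ ∑ i ∈ J, v j i) ∧
      ∀ l ∈ J, ∀ Z ⊆ J.erase l, ∀ c : ℕ, (∀ j, c ≤ ∑ i ∈ J, v j i) → L ≤ c →
        mu (fun j => succ J l Z c (v j)) < mu v := by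
  classical
  obtain ⟨j₀, hj₀⟩ := exists_least_of_incPairs_eq_empty h j₁
  -- minimal-cardinality `J` with `L ≤ Σ_J v j₀`
  obtain ⟨J, hJmem, hJmin⟩ := ((univ : Finset (Fin n)).powerset.filter fun J => L ≤ ∑ i ∈ J, v j₀ i).exists_min_image
    Finset.card ⟨univ, by simpa [total] using hbad j₀⟩
  rw [Finset.mem_filter] at hJmem
  obtain ⟨-, hJL⟩ := hJmem
  have hJne : J.Nonempty := by
    by_contra hne
    rw [Finset.not_nonempty_iff_eq_empty] at hne
    rw [hne, Finset.sum_empty] at hJL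
    omega
  have hJerase : ∀ l ∈ J, ∑ i ∈ J.erase l, v j₀ i < L := by
    intro l hl
    by_contra hge
    push Not at hge
    have hmem : J.erase l ∈ (univ : Finset (Fin n)).powerset.filter fun J => L ≤ ∑ i ∈ J, v j₀ i := by
      rw [Finset.mem_filter, Finset.mem_powerset]
      exact ⟨Finset.subset_univ _, hge⟩
    have := hJmin _ hmem
    rw [Finset.card_erase_of_mem hl] at this
    have hpos : 0 < J.card := Finset.card_pos.mpr ⟨l, hl⟩
    omega
  have hperm : ∀ j, L ≤ ∑ i ∈ J, v j i := fun j => hJL.trans (Finset.sum_le_sum fun i _ => hj₀ j i)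
  refine ⟨J, hJne, hperm, fun l hl Z hZ c hc hLc => ?_⟩
  set v' : S → Fin n → ℕ := fun j => succ J l Z c (v j) with hv'
  have h' : incPairs v' = ∅ := Finset.subset_empty.mp (h ▸ incPairs_succ_subset J l Z c v)
  have hμv : mu v = ((⨅ j, total (v j) : ℕ) : Ordinal.{0}) := by
    unfold mu; rw [dif_neg (by rw [h]; exact Finset.not_nonempty_empty)]
  have hμv' : mu v' = ((⨅ j, total (v' j) : ℕ) : Ordinal.{0}) := by
    unfold mu; rw [dif_neg (by rw [h']; exact Finset.not_nonempty_empty)]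
  haveI : Nonempty S := ⟨j₁⟩
  rw [hμv, hμv', Nat.cast_lt]
  have h1 : (⨅ j, total (v' j)) ≤ total (v' j₀) := ciInf_le (OrderBot.bddBelow _) j₀
  have h2 : total (v' j₀) < total (v j₀) := total_succ_lt hl hZ (hc j₀) hLc (hJerase l hl)
  have h3 : total (v j₀) = ⨅ j, total (v j) := by
    refine le_antisymm ?_ (ciInf_le (OrderBot.bddBelow _) j₀)
    exact le_ciInf fun j => Finset.sum_le_sum fun i _ => hj₀ j i
  omega

/-! ### The step and the invariance under re-indexing -/
/-- **THE WINNING MOVE OF THE MARKED POLYHEDRA GAME.**  From a non-empty cloud with every `|v_j| ≥ L` (`L ≥ 1`) there is `J ≠ ∅` such that for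
every floor weight `W` — any `W` with `L·W ≤ Σ_J v_j` for all `j`, and `W ≥ 1` as soon as `Σ_J v_j ≥ L` for all `j` — every successor (live slot
`l ∈ J`, units `Z ⊆ J ∖ {l}`, shift `L·W`) has smaller potential. -/
theorem exists_move (v : S → Fin n → ℕ) (j₁ : S) {L : ℕ} (hL : 1 ≤ L) (hbad : ∀ j, L ≤ total (v j)) :
    ∃ J : Finset (Fin n), J.Nonempty ∧ ∀ W : ℕ, (∀ j, L * W ≤ ∑ i ∈ J, v j i) →
      ((∀ j, L ≤ ∑ i ∈ J, v j i) → 1 ≤ W) →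
      ∀ l ∈ J, ∀ Z ⊆ J.erase l, mu (fun j => succ J l Z (L * W) (v j)) < mu v := by
  by_cases h : (incPairs v).Nonempty
  · obtain ⟨J, hJ, hstep⟩ := mu_succ_lt_of_incPairs h
    exact ⟨J, hJ, fun W hW _ l hl Z hZ => hstep l hl Z hZ (L * W) hW⟩
  · rw [Finset.not_nonempty_iff_eq_empty] at h
    obtain ⟨J, hJ, hperm, hstep⟩ := mu_succ_lt_of_chain h j₁ hL hbad
    refine ⟨J, hJ, fun W hW hW1 l hl Z hZ => hstep l hl Z hZ (L * W) hW ?_⟩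
    have := hW1 hperm
    calc L = L * 1 := (mul_one L).symm
      _ ≤ L * W := Nat.mul_le_mul_left L this

/-- Re-indexing the coordinates does not change the incomparable pairs. -/
theorem incPairs_comp_equiv (σ : Fin n ≃ Fin n) (v : S → Fin n → ℕ) :
    incPairs (fun j => v j ∘ σ) = incPairs v := by
  unfold incPairs
  simp_rw [posExcess_comp_equiv]

/-- **`mu` is invariant under a common re-indexing of the coordinates.** -/
theorem mu_comp_equiv (σ : Fin n ≃ Fin n) (v : S → Fin n → ℕ) : mu (fun j => v j ∘ σ) = mu v := by
  have hinc := incPairs_comp_equiv σ v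
  have hpot : pairPot (fun j => v j ∘ σ) = pairPot v := by
    funext p; unfold pairPot; simp_rw [Function.comp_def]
    rw [show (fun x => v p.1 (σ x)) = v p.1 ∘ σ from rfl, show (fun x => v p.2 (σ x)) = v p.2 ∘ σ from rfl,
      posExcess_comp_equiv, posExcess_comp_equiv]
  have htot : ∀ j, total (v j ∘ σ) = total (v j) := fun j => by
    unfold total; exact Fintype.sum_equiv σ _ _ fun _ => rfl
  unfold mu
  simp only [hinc, hpot, htot]


/-- Re-indexing the POINTS of the cloud along an equivalence does not change the incomparable pairs (up to the induced bijection). -/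
theorem incPairs_comp_index_equiv {S' : Type} [Fintype S'] (e : S' ≃ S) (v : S → Fin n → ℕ) :
    incPairs (fun j' => v (e j')) = (incPairs v).map (Equiv.prodCongr e e).symm.toEmbedding := by
  ext p
  rw [mem_incPairs, Finset.mem_map_equiv, mem_incPairs]
  simp [Equiv.prodCongr_apply]

/-- **`mu` is invariant under re-indexing the points of the cloud.** -/
theorem mu_comp_index_equiv {S' : Type} [Fintype S'] (e : S' ≃ S) (v : S → Fin n → ℕ) :
    mu (fun j' => v (e j')) = mu v := by
  have hinc := incPairs_comp_index_equiv e v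
  have himg : (incPairs fun j' => v (e j')).image (pairPot fun j' => v (e j')) = (incPairs v).image (pairPot v) := by
    ext o
    constructor
    · intro ho
      obtain ⟨p, hp, rfl⟩ := Finset.mem_image.mp ho
      rw [hinc, Finset.mem_map_equiv] at hp
      exact Finset.mem_image.mpr ⟨Prod.map e e p, by simpa [Equiv.prodCongr_apply] using hp, rfl⟩
    · intro ho
      obtain ⟨q, hq, rfl⟩ := Finset.mem_image.mp ho
      refine Finset.mem_image.mpr ⟨(e.symm q.1, e.symm q.2), ?_, ?_⟩
      · rw [hinc, Finset.mem_map_equiv]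
        simpa [Equiv.prodCongr_apply] using hq
      · simp [pairPot]
  have htot : (⨅ j', total (v (e j'))) = ⨅ j, total (v j) := Equiv.iInf_comp (g := fun j => total (v j)) e
  unfold mu
  by_cases h : (incPairs v).Nonempty
  · have h' : (incPairs fun j' => v (e j')).Nonempty := by rw [hinc]; exact h.map
    rw [dif_pos h', dif_pos h]
    have hcard : (incPairs fun j' => v (e j')).card = (incPairs v).card := by rw [hinc, Finset.card_map]
    rw [hcard]
    congr 1
    simp only [himg]
  · have h' : ¬ (incPairs fun j' => v (e j')).Nonempty := by
      rw [hinc]; intro hne; exact h (Finset.map_nonempty.mp hne)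
    rw [dif_neg h', dif_neg h, htot]

end MonomialCloud

end Summit.ResolutionOfSingularities.ResolutionOfSingularities.Theorems
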